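import Literature.IUT.HodgeTheaters.PiAvatarOrbitCategoryProofs
import Literature.IUT.HodgeTheaters.InitialThetaDataLocalGroups
import Literature.IUT.HodgeTheaters.PuncturedEllipticCoveringsBasic
import HarnessLib

/-!
# The negative automorphism of `𝒟_v̲ = ℬ(X̲→_v̲)⁰` at a good place AT THE GENUINE INITIAL Θ-DATA: the index-two
# involution `Π_{X̲→_v̲} ⊴ Π_{C̲→_v̲}` survives base change to the decomposition group (proof-only; KIT-INSTANCE-SPEC P5)

S. Mochizuki, *Inter-universal Teichmüller theory I*, kurims manuscript (May 2020), §1 pp. 37–38 (the coverings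
`X̲→ → C̲→` with "`Gal(X̲→/C̲) ≅ ℤ/2l`", "`Gal(C̲→/C̲) ≅ ℤ/l`"), Def 3.1 (e)(f) pp. 62–63 ("`Π_v̲ := Π_{X̲→_v̲}`" for
`v̲ ∈ V̲^good`; base change to `K_v̲`), Example 3.3 (i) p. 77 (`𝒟_v := ℬ(X̲→_v̲)⁰` at good nonarchimedean `v̲`),
Def 6.1 (iii) p. 157 ("the `𝔽_l^±`-group structure determines a natural surjection `Aut(†𝒟_v) ↠ {±1}` … negative
automorphisms") ([IUTchI] Def 6.1 (iii) p.157) [claim: Mochizuki2012, status: disputed] (D-0012 claim key, series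
status DISPUTED — group-theoretic plumbing + an instance-level consequence over abc-iut-L5-t2's REAL `InitialThetaData`;
nothing of the series is asserted, no side is taken on [IUTchIII] Cor. 3.12).

* `OrbitCat.relIndex_inf_comap_eq_two` — an index-two pair `X ≤ C` stays index two after intersecting with the
  preimage `f⁻¹(P)` of ANY subgroup under a homomorphism `f`, provided `f(C) ⊆ f(X)` (the base-change step
  `Π_{(−)_v̲} := Π_{(−)} ×_{G_F} G_v̲` of Def 3.1 (e), read as the subgroup `Π_{(−)} ∩ augGF⁻¹(G_v̲)` of `Π_{C_F}` —
  abc-iut-L5-t2's `range_fstLoc`);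
* `PuncturedEllipticData.piXarrow_relIndex_piCarrow` — `[Π_{C̲→} : Π_{X̲→}] = 2`, from abc-iut-L5-t1's printed §1
  claims (`ArrowCoveringClaims`: indices `2l`, `l` in `Π_{C̲}`) — HYPOTHESIS `hA`, the typed form of pp. 37–38;
* instance: `InitialThetaData.piXarrow_relIndex_piCarrow` (in `Π_{C_F}`, along `embK`) and
  **`InitialThetaData.exists_localInvolution_of_le`** — for every subgroup `Gv ≤ G_K` of `G_F` (a decomposition group
  `G_v̲`, e.g. abc-iut-L5-t2's `decompositionSubgroupGF`), the object `ℬ(Π_{X̲→_K} ∩ augGF⁻¹ Gv)⁰ = ℬ(Π_{X̲→_v̲})⁰ = 𝒟_v̲`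
  of the orbit category of `Π_{C_F}` has a NON-TRIVIAL INVOLUTIVE automorphism induced by `Π_{C̲→_v̲}` — a NEGATIVE
  automorphism of Def 6.1 (iii) (the kit field `exists_negative` at good `v̲`, Π-level), conditional only on `hA`.

Proof-only; typed ≠ proved elsewhere.
-/

namespace Literature.IUT.HodgeTheaters

open CategoryTheory

universe u v w

namespace OrbitCat

/-- **Index two survives base change.** Let `f : A →* G`, `X ≤ C ≤ A` with `[C : X] = 2`, and suppose `f(C) ⊆ f(X)`
(e.g. both surject onto the same subgroup). Then for every subgroup `P ≤ G`, `[C ∩ f⁻¹P : X ∩ f⁻¹P] = 2`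
([IUTchI] Def 3.1 (e): base change of `X̲_K → C̲_K`, `X̲→ → C̲→` to a decomposition group keeps the degree).
([IUTchI] Def 3.1 (e) p.62) [claim: Mochizuki2012, status: disputed] -/
theorem relIndex_inf_comap_eq_two {A G : Type*} [Group A] [Group G] (f : A →* G) {X C : Subgroup A}
    (hXC : X ≤ C) (h2 : X.relIndex C = 2) (hfc : C.map f ≤ X.map f) (P : Subgroup G) :
    (X ⊓ P.comap f).relIndex (C ⊓ P.comap f) = 2 := by
  rw [Subgroup.relIndex_eq_two_iff_exists_notMem_and]
  -- an element of `C \ X` with trivial image (hence in `f⁻¹ P`)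
  obtain ⟨a₀, ha₀C, ha₀X, -⟩ := Subgroup.relIndex_eq_two_iff_exists_notMem_and.mp h2
  obtain ⟨x₀, hx₀X, hx₀⟩ := hfc ⟨a₀, ha₀C, rfl⟩
  have haC : a₀ * x₀⁻¹ ∈ C := C.mul_mem ha₀C (C.inv_mem (hXC hx₀X))
  have haX : a₀ * x₀⁻¹ ∉ X := fun h => ha₀X (by simpa using X.mul_mem h hx₀X)
  have haP : a₀ * x₀⁻¹ ∈ P.comap f := by
    rw [Subgroup.mem_comap, map_mul, map_inv, hx₀, mul_inv_cancel]
    exact P.one_mem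
  refine ⟨a₀ * x₀⁻¹, ⟨haC, haP⟩, fun h => haX h.1, ?_⟩
  rintro b ⟨hbC, hbP⟩
  by_cases hbX : b ∈ X
  · exact Or.inr ⟨hbX, hbP⟩
  · left
    refine ⟨?_, (P.comap f).mul_mem hbP haP⟩
    -- index two in `C`: `b, a ∉ X ⇒ b a ∈ X`
    have key := (Subgroup.mul_mem_iff_of_index_two h2 (a := ⟨b, hbC⟩) (b := ⟨a₀ * x₀⁻¹, haC⟩)).2
    have hmem : (⟨b, hbC⟩ * ⟨a₀ * x₀⁻¹, haC⟩ : C) ∈ X.subgroupOf C := by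
      apply key
      simp only [Subgroup.mem_subgroupOf]
      exact ⟨fun h => absurd h hbX, fun h => absurd h haX⟩
    exact Subgroup.mem_subgroupOf.mp hmem

end OrbitCat

/-! ### `[Π_{C̲→} : Π_{X̲→}] = 2` from the printed §1 claims -/

namespace PuncturedEllipticData

/-- From the §1 claims "`Gal(X̲→/C̲) ≅ ℤ/2l`", "`Gal(C̲→/C̲) ≅ ℤ/l`" (indices `2l`, `l`; abc-iut-L5-t1's
`ArrowCoveringClaims`, a HYPOTHESIS = the typed printed claims of pp. 37–38): `[Π_{C̲→} : Π_{X̲→}] = 2`.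
([IUTchI] §1 p.38) [claim: Mochizuki2012, status: disputed] -/
theorem piXarrow_relIndex_piCarrow (pe : PuncturedEllipticData.{u}) (hA : pe.ArrowCoveringClaims) :
    pe.piXarrow.relIndex pe.piCarrow = 2 := by
  have h := Subgroup.relIndex_mul_relIndex _ _ _ pe.piXarrow_le_piCarrow pe.piCarrow_le_piCbar
  rw [hA.piXarrow_relindex, hA.piCarrow_relindex] at h
  have hl : 0 < pe.l := lt_of_lt_of_le (by norm_num) pe.five_le
  -- `r * l = 2 * l`
  exact Nat.eq_of_mul_eq_mul_right hl h

end PuncturedEllipticData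

/-! ### Instance: the negative automorphism of `𝒟_v̲ = ℬ(X̲→_v̲)⁰` at the genuine data -/

section Local

variable {F : Type u} {K : Type v} {Fbar : Type w} [Field F] [NumberField F] [Field K]
  [NumberField K] [Algebra F K] [Field Fbar] [Algebra F Fbar] [Algebra K Fbar]
  {E : WeierstrassCurve F} [E.IsElliptic] {l : ℕ} {P : BadPlacePredicates K}
  (D : InitialThetaData F K Fbar E l P)

namespace InitialThetaData

/-- `Π_{X̲→_K} ≤ Π_{C̲→_K}` inside `Π_{C_F}` (Def 3.1 (f); t1's `piXarrow_le_piCarrow` along `embK`).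
([IUTchI] Def 3.1 (f) p.63) [claim: Mochizuki2012, status: disputed] -/
theorem PiXarrow_le_PiCarrow : D.PiXarrow ≤ D.PiCarrow :=
  Subgroup.map_mono D.geom.pe.piXarrow_le_piCarrow

/-- `[Π_{C̲→_K} : Π_{X̲→_K}] = 2` inside `Π_{C_F}`, under the printed §1 claims for the datum at `K`.
([IUTchI] Def 3.1 (f) p.63) [claim: Mochizuki2012, status: disputed] -/
theorem piXarrow_relIndex_piCarrow (hA : D.geom.pe.ArrowCoveringClaims) :
    D.PiXarrow.relIndex D.PiCarrow = 2 := by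
  rw [InitialThetaData.PiXarrow, InitialThetaData.PiCarrow,
    Subgroup.relIndex_map_map_of_injective _ _ D.geom.embK_injective]
  exact D.geom.pe.piXarrow_relIndex_piCarrow hA

/-- `augGF(Π_{C̲→_K}) ⊆ G_K ⊆ augGF(Π_{X̲→_K})`: both surject onto `G_K` (t2's `galoisSubgroupOf_le_map_PiXarrow`;
`Π_{C̲→_K} ≤ Π_{C_K}` maps into `G_K` by `ThetaGeometry.aug_compat`). ([IUTchI] Def 3.1 (f) p.63) [claim: Mochizuki2012, status: disputed] -/
theorem map_augGF_PiCarrow_le : D.PiCarrow.map D.augGF ≤ D.PiXarrow.map D.augGF := by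
  refine le_trans ?_ D.galoisSubgroupOf_le_map_PiXarrow
  rintro g ⟨y, hy, rfl⟩
  obtain ⟨z, -, rfl⟩ := hy
  rw [augGF_apply, D.geom.aug_compat]
  exact (D.geom.galKIso (D.geom.pe.E.aug z)).2

/-- **The negative automorphism of `𝒟_v̲` at a good place, AT THE GENUINE DATA.** For every subgroup `Gv` of `G_F`
(a decomposition group `G_v̲ ⊆ G_K`, e.g. abc-iut-L5-t2's `decompositionSubgroupGF`), write
`Π_{X̲→_v̲} := Π_{X̲→_K} ∩ augGF⁻¹(Gv)`, `Π_{C̲→_v̲} := Π_{C̲→_K} ∩ augGF⁻¹(Gv)` (the base changes of Def 3.1 (e), as subgroups of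
`Π_{C_F}`: t2's `range_fstLoc`).  Then `[Π_{C̲→_v̲} : Π_{X̲→_v̲}] = 2` and some `c ∈ Π_{C̲→_v̲} \ Π_{X̲→_v̲}` induces, in the
orbit category of `Π_{C_F}`, an automorphism of `𝒟_v̲ = ℬ(Π_{X̲→_v̲})⁰` that is NOT the identity and SQUARES to the
identity — a negative automorphism of Def 6.1 (iii) (the kit field `exists_negative` at good `v̲`, Π-level),
conditional only on the printed §1 claims `hA`. ([IUTchI] Def 6.1 (iii) p.157) [claim: Mochizuki2012, status: disputed] -/
theorem exists_localInvolution (hA : D.geom.pe.ArrowCoveringClaims) (Gv : Subgroup (Fbar ≃ₐ[F] Fbar)) :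
    (D.PiXarrow ⊓ Gv.comap D.augGF).relIndex (D.PiCarrow ⊓ Gv.comap D.augGF) = 2 ∧
    ∃ (c : D.PiC)
      (hc : c ∈ Subgroup.normalizer ((D.PiXarrow ⊓ Gv.comap D.augGF : Subgroup D.PiC) : Set D.PiC)),
      c ∈ D.PiCarrow ⊓ Gv.comap D.augGF ∧ c ∉ D.PiXarrow ⊓ Gv.comap D.augGF ∧
      OrbitCat.autOfNormalizer c hc ≠ Iso.refl (OrbitCat.of (D.PiXarrow ⊓ Gv.comap D.augGF)) ∧
      OrbitCat.autOfNormalizer c hc ≪≫ OrbitCat.autOfNormalizer c hc =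
        Iso.refl (OrbitCat.of (D.PiXarrow ⊓ Gv.comap D.augGF)) := by
  have h2 : (D.PiXarrow ⊓ Gv.comap D.augGF).relIndex (D.PiCarrow ⊓ Gv.comap D.augGF) = 2 :=
    OrbitCat.relIndex_inf_comap_eq_two D.augGF D.PiXarrow_le_PiCarrow (D.piXarrow_relIndex_piCarrow hA)
      D.map_augGF_PiCarrow_le Gv
  exact ⟨h2, OrbitCat.exists_involution_of_relIndex_eq_two (inf_le_inf_right _ D.PiXarrow_le_PiCarrow) h2⟩

end InitialThetaData

end Local

end Literature.IUT.HodgeTheaters
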